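import Literature.NumberTheory.Automorphic.KimExteriorSquareGL4Archimedean
import Literature.NumberTheory.Automorphic.ArchParameterUnique
import HarnessLib

/-!
# Kim's exterior square lift `∧² : GL₄ → GL₆`, archimedean clause: the algebra of `∧²` on
# Harish-Chandra parameters and infinity types, and Theorem A at `∞` in the form in which it is used

Sibling proof file (theorems only; no `sorry`, no named fact, no definition) of
`Literature.NumberTheory.Automorphic.KimExteriorSquareGL4Archimedean`, whose named fact
`Kim2003_exteriorSquare_GL4_archimedean` renders H. H. Kim, *Functoriality for the exterior square
of `GL₄` and the symmetric fourth of `GL₂`*, J. Amer. Math. Soc. **16** (2003) 139–183 [Kim2002],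
Theorem A (p. 139) = Thm. 5.3.1 (p. 165) together with its archimedean clause (`Π_v ≃ ∧²π_v` at
every archimedean `v`, rendered on Harish-Chandra parameters: `χ ↦ (σ ↦ wedgeTwoArchParams (χ σ))`,
pairwise sums of exponents).

## What is proved here

* The algebra of `wedgeTwoArchParams` (`{aᵢ + aⱼ : i < j}`): `_zero/_singleton/_cons/_four`,
  membership (`mem_wedgeTwoArchParams_iff`), the **twist rule** `wedgeTwoArchParams_map_add`
  (`∧²(π ⊗ |det|^s) = ∧²π ⊗ |det|^{2s}` on exponents: shifting `χ` by `s` shifts `∧²χ` by `2s` —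
  the normalisation remark of the fact's docstring, Kim p. 139 "cuspidal = unitary cuspidal"), the
  **central character rule** `sum_wedgeTwoArchParams` (`∑ ∧²χ = (n - 1) ∑ χ`, i.e.
  `ω_{∧²π} = ω_π^{n-1}` at `∞`; `ω_Π = ω_π³` for `n = 4`, Kim p. 154), and the **integrality
  rules** `wedgeTwoArchParams_mem_int_add` / `_integral` / `_integral_of_halfIntegral`: exponents in
  `s + ℤ` go to exponents in `2s + ℤ`, so integral (L-algebraic) parameters stay integral and
  half-integral (C-algebraic, `(n-1)/2 + ℤ`) parameters become integral.
* `InfinityType.exists_wedgeTwo` — **the exterior square of an infinity type**: a well-formed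
  `T : InfinityType K n` has a well-formed exterior square `T₂ : InfinityType K (n choose 2)`
  (pairwise sums of weights `(aᵢ + aⱼ, bᵢ + bⱼ)`), whose `a`- and `b`-multisets are
  `wedgeTwoArchParams` of those of `T`, L-algebraic when `T` is L-algebraic **or C-algebraic**
  (Buzzard–Gee 2014, §3.1: `z^{aᵢ} z̄^{bᵢ} · z^{aⱼ} z̄^{bⱼ}`; `2 · (n-1)/2 ∈ ℤ`).
* `AutomorphicRepData.isLAlgebraic_of_hasArchParameter_wedgeTwo` — an automorphic `P` on `GL₆`
  whose archimedean parameter is `∧²` of that of an L- or C-algebraic `π` on `GL₄` is L-algebraic;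
  and `AutomorphicRepData.infinityType_map_a_eq_wedgeTwo` — every infinity type of such a `P` has
  `a`-multisets `∧²` of those of `π` (uniqueness of archimedean parameters,
  `AutomorphicRepData.hasArchParameter_unique`, a theorem of the tree; Clozel 1990 §3.3).
* `Kim2003_exteriorSquare_GL4_archimedean.exists_lift_isLAlgebraic` — **Theorem A at `∞` in the
  form in which it is used** (by `Summit.Langlands.Langlands.Theses.K3KugaSatakeDescent`, item
  `WedgeSquareDescent`): under the named fact, the exterior square lift `Π` of an L-algebraic (or
  C-algebraic) cuspidal `π` on `GL₄(𝔸_F)` is an **L-algebraic** automorphic representation of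
  `GL₆(𝔸_F)` with `t_{Π,v} = ∧² t_{π,v}` at almost every finite `v` and the isobaric clause.

## Status of the discharge `Kim2003_exteriorSquare_GL4_archimedean_holds` (triage: XL)

The fact contains verbatim the tree's `Kim2003_exteriorSquare_GL4` (projection
`Kim2003_exteriorSquare_GL4_archimedean.satake`), itself undischarged and triaged XL in
`KimExteriorSquareGL4Proofs` (module docstring there: converse theorem of Cogdell–Piatetski-Shapiro,
Langlands–Shahidi `L`-functions on `Spin(2n)`, local Langlands, Jacquet–Shalika classification,
Henniart/Arthur–Clozel/Ramakrishnan descent — none carried by the tree). The printed proof of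
Theorem A = Thm. 5.3.1 (p. 165) is: apply the converse theorem (Thm. 2.1) twice to the candidate
`Π' = ⊗_v Π'_v` (`Π'_v = ∧²π_v` for `v ∉ T`, the local lifts of §5.2 for `v ∈ T`) with
`S₁ = {v₁}`, `S₂ = {v₂}`; "by Theorem 4.2.3, `Π₁` and `Π₂` are of the form `σ₁ ⊞ ⋯ ⊞ σ_k`"; strong
multiplicity one gives `Π₁ ≃ Π₂ ≃ Π'`. Theorem 4.2.3 is `Kim2003_exteriorSquare_GL4`; so the
discharge of this fact is parked on that one. Nothing in this file assumes the fact except the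
consequence named `Kim2003_exteriorSquare_GL4_archimedean.exists_lift_isLAlgebraic`, which takes it
as the hypothesis `h`.

## References

* [Kim2002] H. H. Kim, *Functoriality for the exterior square of GL₄ and the symmetric fourth of
  GL₂*, J. Amer. Math. Soc. 16 (2003), 139–183: Theorem A (p. 139), §1 p. 139 (`∧²π_v` through the
  local Langlands correspondence, Langlands [La4] at archimedean places), p. 154 (`ω_Π = ω_π³`),
  Thm. 4.2.3 (p. 156), Thm. 5.3.1 (p. 165).
* K. Buzzard, T. Gee, *The conjectural connections between automorphic representations and Galois
  representations* (2014), §3.1 (L- and C-algebraic; weights `z^{a} z̄^{b}`). [BuzzardGee2014]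
* L. Clozel, *Motifs et formes automorphes* (1990), §3.3. [Clozel1990]
-/

noncomputable section

open scoped Classical MatrixGroups
open IsDedekindDomain NumberField

namespace Literature.NumberTheory.Automorphic

/-! ### The algebra of `∧²` on archimedean parameters -/

/-- `∧²` of the empty parameter is empty. [folklore] -/
@[simp] theorem wedgeTwoArchParams_zero : wedgeTwoArchParams 0 = 0 := by
  simp [wedgeTwoArchParams]

/-- `∧²` of a one-element parameter is empty (`∧² : GL₁ → GL₀`). [folklore] -/
@[simp] theorem wedgeTwoArchParams_singleton (a : ℂ) : wedgeTwoArchParams {a} = 0 := by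
  simp [wedgeTwoArchParams, Multiset.powersetCard_eq_empty]

/-- **Recursion for `∧²` on exponents.** Adjoining an exponent `a` to `χ` adds the sums `a + χⱼ`:
`∧²(a ⊕ χ) = (a + χ) ⊎ ∧²χ` (the branching `∧²(L ⊕ V) = L ⊗ V ⊕ ∧²V`, characters of `ℂ^×`
multiply, exponents add). [folklore] -/
theorem wedgeTwoArchParams_cons (a : ℂ) (χ : Multiset ℂ) :
    wedgeTwoArchParams (a ::ₘ χ) = χ.map (a + ·) + wedgeTwoArchParams χ := by
  simp only [wedgeTwoArchParams, Multiset.powersetCard_cons, Multiset.map_add,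
    Multiset.powersetCard_one, Multiset.map_map, Function.comp_def, Multiset.sum_cons,
    Multiset.sum_singleton]
  exact add_comm _ _

/-- **`∧²` of a `GL₄` archimedean parameter**, explicitly:
`∧²{a, b, c, d} = {a+b, a+c, a+d, b+c, b+d, c+d}` — the six exponents of `∧²π_v` at an embedding
when `π_v` has exponents `{a, b, c, d}` there (Kim 2003, §1 p. 139: `∧²π_v` through Langlands'
archimedean correspondence). [cite: Kim2002, §1 p. 139] -/
theorem wedgeTwoArchParams_four (a b c d : ℂ) :
    wedgeTwoArchParams {a, b, c, d} = {a + b, a + c, a + d, b + c, b + d, c + d} := by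
  simp only [Multiset.insert_eq_cons, wedgeTwoArchParams_cons, wedgeTwoArchParams_singleton,
    Multiset.map_cons, Multiset.map_singleton, Multiset.cons_add, Multiset.singleton_add, add_zero]

/-- Membership in `∧²χ`: the elements are the sums `a + b` over the `2`-element sub-multisets
`{a, b} ≤ χ`. [folklore] -/
theorem mem_wedgeTwoArchParams_iff {χ : Multiset ℂ} {c : ℂ} :
    c ∈ wedgeTwoArchParams χ ↔ ∃ a b : ℂ, ({a, b} : Multiset ℂ) ≤ χ ∧ a + b = c := by
  simp only [wedgeTwoArchParams, Multiset.mem_map, Multiset.mem_powersetCard]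
  constructor
  · rintro ⟨t, ⟨ht, hcard⟩, rfl⟩
    obtain ⟨a, b, rfl⟩ := Multiset.card_eq_two.mp hcard
    exact ⟨a, b, ht, by simp⟩
  · rintro ⟨a, b, h, rfl⟩
    exact ⟨{a, b}, ⟨h, by simp⟩, by simp⟩

/-- **Twisting rule.** Shifting every exponent by `s` shifts the exterior square by `2s`:
`∧²(χ + s) = ∧²χ + 2s` — on archimedean parameters, `∧²(π ⊗ |det|^s) = ∧²π ⊗ |det|^{2s}`, the
passage between Kim's unitary normalisation ("a cuspidal representation always means a unitary
one", p. 139) and arbitrary cuspidal data recorded in the docstring of the fact. [folklore] -/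
theorem wedgeTwoArchParams_map_add (χ : Multiset ℂ) (s : ℂ) :
    wedgeTwoArchParams (χ.map (· + s)) = (wedgeTwoArchParams χ).map (· + 2 * s) := by
  simp only [wedgeTwoArchParams, Multiset.powersetCard_map, Multiset.map_map, Function.comp_def]
  refine Multiset.map_congr rfl fun t ht => ?_
  rw [Multiset.sum_map_add, Multiset.map_const', Multiset.sum_replicate, Multiset.map_id',
    (Multiset.mem_powersetCard.mp ht).2, nsmul_eq_mul, Nat.cast_ofNat]

/-- **Central character rule.** `∑ ∧²χ = (n - 1) · ∑ χ` for `n = card χ` (each exponent occurs in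
`n - 1` pairs): at `∞` this is `ω_{∧²π} = ω_π^{n-1}`; for `n = 4`, `ω_Π = ω_π³` (Kim 2003, p. 154:
"the central character of `Π` is `ω_Π = ω_π³`"). [cite: Kim2002, §4.1, p. 154] -/
theorem sum_wedgeTwoArchParams (χ : Multiset ℂ) :
    (wedgeTwoArchParams χ).sum = ((Multiset.card χ : ℂ) - 1) * χ.sum := by
  induction χ using Multiset.induction_on with
  | empty => simp
  | cons a s ih =>
    rw [wedgeTwoArchParams_cons, Multiset.sum_add, ih, Multiset.sum_map_add, Multiset.map_const',
      Multiset.sum_replicate, Multiset.map_id', Multiset.card_cons, Multiset.sum_cons, nsmul_eq_mul]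
    push_cast
    ring

/-- For a `GL₄` parameter (`card χ = 4`): `∑ ∧²χ = 3 ∑ χ` (`ω_Π = ω_π³` at `∞`).
[cite: Kim2002, §4.1, p. 154] -/
theorem sum_wedgeTwoArchParams_of_card_eq_four {χ : Multiset ℂ} (hχ : Multiset.card χ = 4) :
    (wedgeTwoArchParams χ).sum = 3 * χ.sum := by
  rw [sum_wedgeTwoArchParams, hχ]
  norm_num

/-- **Integrality rule.** If every exponent of `χ` lies in `s + ℤ`, every exponent of `∧²χ` lies in
`2s + ℤ` (sums of two). [folklore] -/
theorem wedgeTwoArchParams_mem_int_add {χ : Multiset ℂ} {s : ℂ}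
    (h : ∀ a ∈ χ, ∃ k : ℤ, a = k + s) :
    ∀ c ∈ wedgeTwoArchParams χ, ∃ k : ℤ, c = k + 2 * s := by
  intro c hc
  obtain ⟨a, b, hab, rfl⟩ := mem_wedgeTwoArchParams_iff.mp hc
  obtain ⟨k, hk⟩ := h a (Multiset.subset_of_le hab (by simp))
  obtain ⟨l, hl⟩ := h b (Multiset.subset_of_le hab (by simp))
  exact ⟨k + l, by push_cast; linear_combination hk + hl⟩

/-- Integral exponents stay integral under `∧²` (L-algebraicity is preserved: Buzzard–Gee 2014,
Def. 3.1.1). [cite: BuzzardGee2014, §3.1] -/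
theorem wedgeTwoArchParams_integral {χ : Multiset ℂ} (h : ∀ a ∈ χ, ∃ k : ℤ, a = k) :
    ∀ c ∈ wedgeTwoArchParams χ, ∃ k : ℤ, c = k := by
  intro c hc
  obtain ⟨k, hk⟩ := wedgeTwoArchParams_mem_int_add (s := 0) (fun a ha => by simpa using h a ha) c hc
  exact ⟨k, by simpa using hk⟩

/-- Half-integral exponents (`(n-1)/2 + ℤ`, C-algebraic for `GL_n`) become **integral** under `∧²`
(`2 · (n-1)/2 = n - 1 ∈ ℤ`): the exterior square of a C-algebraic parameter is L-algebraic.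
Buzzard–Gee 2014, §3.1 and Def. 5.3.3. [cite: BuzzardGee2014, §3.1] -/
theorem wedgeTwoArchParams_integral_of_halfIntegral {χ : Multiset ℂ} {n : ℕ}
    (h : ∀ a ∈ χ, ∃ k : ℤ, a = k + ((n : ℂ) - 1) / 2) :
    ∀ c ∈ wedgeTwoArchParams χ, ∃ k : ℤ, c = k := by
  intro c hc
  obtain ⟨k, hk⟩ := wedgeTwoArchParams_mem_int_add h c hc
  exact ⟨k + n - 1, by rw [hk]; push_cast; ring⟩

/-! ### The exterior square of an infinity type -/

/-- The exponents of a sum of archimedean weights again differ by an integer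
(`∑ aᵢ - ∑ bᵢ = ∑ (aᵢ - bᵢ) ∈ ℤ`): products of the characters `z^{aᵢ} z̄^{bᵢ}` of `ℂ^×` are
characters. Buzzard–Gee 2014, §3.1. [cite: BuzzardGee2014, §3.1] -/
theorem ArchWeight.exists_int_sum_sub (t : Multiset ArchWeight) :
    ∃ m : ℤ, (t.map ArchWeight.a).sum - (t.map ArchWeight.b).sum = m := by
  induction t using Multiset.induction_on with
  | empty => exact ⟨0, by simp⟩
  | cons p t ih =>
    obtain ⟨m, hm⟩ := ih
    obtain ⟨k, hk⟩ := p.exists_int_sub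
    refine ⟨k + m, ?_⟩
    simp only [Multiset.map_cons, Multiset.sum_cons]
    push_cast
    linear_combination hk + hm

/-- **The exterior square of an infinity type.** A well-formed infinity type `T` for `GL_n` over
`K` (weights `(aᵢ, bᵢ)_σ`, `T σ̄ = swap (T σ)`) has a well-formed exterior square `T₂` for
`GL_{n choose 2}`: at each `σ` the pairwise sums `(aᵢ + aⱼ, bᵢ + bⱼ)`, `i < j` — the restriction to
`ℂ^×` of `∧²` of the Langlands parameter, `z^{aᵢ} z̄^{bᵢ} · z^{aⱼ} z̄^{bⱼ}`. Its `a`- and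
`b`-multisets are `wedgeTwoArchParams` of those of `T`, and it is L-algebraic as soon as `T` is
L-algebraic or C-algebraic (`aᵢ, bᵢ ∈ (n-1)/2 + ℤ ⇒ aᵢ + aⱼ ∈ (n - 1) + ℤ = ℤ`). Stated as an
existence (`N = n choose 2` as a hypothesis, to be used with `InfinityType K 6` for `n = 4`).
Buzzard–Gee 2014, §3.1; Kim 2003, §1 p. 139. [cite: BuzzardGee2014, §3.1] -/
theorem InfinityType.exists_wedgeTwo {K : Type*} [Field K] {n N : ℕ} (hN : n.choose 2 = N)
    (T : InfinityType K n) (hT : T.IsWellFormed) :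
    ∃ T₂ : InfinityType K N, T₂.IsWellFormed ∧
      (∀ σ, (T₂ σ).map ArchWeight.a = wedgeTwoArchParams ((T σ).map ArchWeight.a)) ∧
      (∀ σ, (T₂ σ).map ArchWeight.b = wedgeTwoArchParams ((T σ).map ArchWeight.b)) ∧
      (T.IsLAlgebraic → T₂.IsLAlgebraic) ∧ (T.IsCAlgebraic → T₂.IsLAlgebraic) := by
  -- the weight of a sub-multiset of weights (componentwise sums), kept opaque: only its two
  -- projections are used below
  obtain ⟨w, hwa, hwb⟩ : ∃ w : Multiset ArchWeight → ArchWeight,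
      (∀ t, (w t).a = (t.map ArchWeight.a).sum) ∧ ∀ t, (w t).b = (t.map ArchWeight.b).sum :=
    ⟨fun t => ⟨_, _, ArchWeight.exists_int_sum_sub t⟩, fun _ => rfl, fun _ => rfl⟩
  have hwa₂ : ∀ p q : ArchWeight, (w {p, q}).a = p.a + q.a := fun p q => by simp [hwa]
  have hwb₂ : ∀ p q : ArchWeight, (w {p, q}).b = p.b + q.b := fun p q => by simp [hwb]
  -- membership in `T₂ σ`: pairs of weights of `T σ`
  have hmem : ∀ (σ : K →+* ℂ) (r : ArchWeight), r ∈ ((T σ).powersetCard 2).map w →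
      ∃ p ∈ T σ, ∃ q ∈ T σ, r = w {p, q} := by
    intro σ r hr
    obtain ⟨t, ht, rfl⟩ := Multiset.mem_map.mp hr
    obtain ⟨hle, hcard⟩ := Multiset.mem_powersetCard.mp ht
    obtain ⟨p, q, rfl⟩ := Multiset.card_eq_two.mp hcard
    exact ⟨p, Multiset.subset_of_le hle (by simp), q, Multiset.subset_of_le hle (by simp), rfl⟩
  refine ⟨fun σ => ((T σ).powersetCard 2).map w, ⟨fun σ => ?_, fun σ => ?_⟩, fun σ => ?_,
    fun σ => ?_, fun hL σ r hr => ?_, fun hC σ r hr => ?_⟩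
  · -- `n choose 2` weights at each embedding
    show Multiset.card (((T σ).powersetCard 2).map w) = N
    rw [Multiset.card_map, Multiset.card_powersetCard, hT.1 σ, hN]
  · -- compatibility with complex conjugation
    show ((T (ComplexEmbedding.conjugate σ)).powersetCard 2).map w =
      (((T σ).powersetCard 2).map w).map ArchWeight.swap
    rw [hT.2 σ, Multiset.powersetCard_map, Multiset.map_map, Multiset.map_map]
    refine Multiset.map_congr rfl fun t _ => ?_
    ext <;> simp [hwa, hwb, Multiset.map_map]
  · -- `a`-multisets
    show (((T σ).powersetCard 2).map w).map ArchWeight.a = _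
    rw [wedgeTwoArchParams, Multiset.powersetCard_map, Multiset.map_map, Multiset.map_map]
    exact Multiset.map_congr rfl fun t _ => by simp [hwa]
  · -- `b`-multisets
    show (((T σ).powersetCard 2).map w).map ArchWeight.b = _
    rw [wedgeTwoArchParams, Multiset.powersetCard_map, Multiset.map_map, Multiset.map_map]
    exact Multiset.map_congr rfl fun t _ => by simp [hwb]
  · -- L-algebraic ⇒ L-algebraic
    obtain ⟨p, hp, q, hq, rfl⟩ := hmem σ r hr
    obtain ⟨k, l, hk, hl⟩ := hL σ p hp
    obtain ⟨k', l', hk', hl'⟩ := hL σ q hq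
    refine ⟨k + k', l + l', ?_, ?_⟩
    · rw [hwa₂]; push_cast; linear_combination hk + hk'
    · rw [hwb₂]; push_cast; linear_combination hl + hl'
  · -- C-algebraic ⇒ L-algebraic (`2 · (n-1)/2 = n - 1 ∈ ℤ`)
    obtain ⟨p, hp, q, hq, rfl⟩ := hmem σ r hr
    obtain ⟨k, l, hk, hl⟩ := hC σ p hp
    obtain ⟨k', l', hk', hl'⟩ := hC σ q hq
    refine ⟨k + k' + n - 1, l + l' + n - 1, ?_, ?_⟩
    · rw [hwa₂]; push_cast; linear_combination hk + hk'
    · rw [hwb₂]; push_cast; linear_combination hl + hl'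

/-! ### Automorphic representations whose archimedean parameter is an exterior square -/

section Arch

variable {F : Type} [Field F] [NumberField F]
  {hF₄ : isCompact_glFiniteIntegralLevel 4 F} {hF₆ : isCompact_glFiniteIntegralLevel 6 F}
  {π : AutomorphicRepData (AutomorphyDatum.gl 4 F hF₄)}
  {P : AutomorphicRepData (AutomorphyDatum.gl 6 F hF₆)}

/-- **`∧²` of an L- or C-algebraic `GL₄` representation is L-algebraic.** If the archimedean
parameter of `P` on `GL₆(𝔸_F)` is `σ ↦ ∧²(χ σ)` whenever `π` on `GL₄(𝔸_F)` has archimedean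
parameter `χ` (the archimedean clause of Kim's Theorem A), and `π` is L-algebraic or C-algebraic,
then `P` is L-algebraic: its infinity type is the exterior square of an infinity type of `π`
(`InfinityType.exists_wedgeTwo`). Buzzard–Gee 2014, §3.1; Kim 2003, Thm. A.
[cite: BuzzardGee2014, §3.1] -/
theorem AutomorphicRepData.isLAlgebraic_of_hasArchParameter_wedgeTwo
    (hP : ∀ χ : (F →+* ℂ) → Multiset ℂ, π.HasArchParameter χ →
      P.HasArchParameter fun σ : F →+* ℂ => wedgeTwoArchParams (χ σ))
    (hπ : π.IsLAlgebraic ∨ π.IsCAlgebraic) : P.IsLAlgebraic := by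
  obtain ⟨T, hT, hTalg⟩ : ∃ T : InfinityType F 4, π.HasInfinityType T ∧
      (T.IsLAlgebraic ∨ T.IsCAlgebraic) := by
    rcases hπ with ⟨T, hT, h⟩ | ⟨T, hT, h⟩
    exacts [⟨T, hT, Or.inl h⟩, ⟨T, hT, Or.inr h⟩]
  obtain ⟨T₂, hwf, ha, -, hL, hC⟩ :=
    InfinityType.exists_wedgeTwo (show (4 : ℕ).choose 2 = 6 by decide) T hT.1
  refine ⟨T₂, ⟨hwf, ?_⟩, hTalg.elim hL hC⟩
  have hfun : (fun σ : F →+* ℂ => (T₂ σ).map ArchWeight.a) =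
      fun σ : F →+* ℂ => wedgeTwoArchParams ((T σ).map ArchWeight.a) := funext ha
  exact hfun ▸ hP _ hT.2

/-- **The infinity type of the lift is determined.** With `hP` as above, every infinity type `T'`
of `P` has `a`-multisets `∧²` of those of any infinity type `T` of `π` at every embedding
(uniqueness of archimedean parameters, `AutomorphicRepData.hasArchParameter_unique`: the
infinitesimal character of `P_∞` determines them; Clozel 1990, §3.3). [cite: Clozel1990, §3.3] -/
theorem AutomorphicRepData.infinityType_map_a_eq_wedgeTwo
    (hP : ∀ χ : (F →+* ℂ) → Multiset ℂ, π.HasArchParameter χ →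
      P.HasArchParameter fun σ : F →+* ℂ => wedgeTwoArchParams (χ σ))
    {T : InfinityType F 4} (hT : π.HasInfinityType T)
    {T' : InfinityType F 6} (hT' : P.HasInfinityType T') (σ : F →+* ℂ) :
    (T' σ).map ArchWeight.a = wedgeTwoArchParams ((T σ).map ArchWeight.a) :=
  congr_fun (P.hasArchParameter_unique hT'.2 (hP _ hT.2)) σ

end Arch

/-! ### Theorem A at `∞` in the form in which it is used -/

/-- **Kim's Theorem A with its archimedean clause, as used** (route
`Summit.Langlands.Langlands.Theses.K3KugaSatakeDescent`, item `WedgeSquareDescent`): under the named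
fact `Kim2003_exteriorSquare_GL4_archimedean`, for every L-algebraic — or C-algebraic — cuspidal
`π` on `GL₄(𝔸_F)` there is an **L-algebraic** automorphic representation `Π` of `GL₆(𝔸_F)` with
`t_{Π,v} = ∧² t_{π,v}` at almost every finite place `v`, archimedean parameter `σ ↦ ∧²(χ σ)`
whenever `π` has archimedean parameter `χ`, and the isobaric clause `Π = σ₁ ⊞ ⋯ ⊞ σ_k` on Satake
parameters (integral exponents stay integral under pairwise sums; half-integral ones become
integral). Kim 2003, Thm. A (p. 139) = Thm. 5.3.1 (p. 165), §1 p. 139; Buzzard–Gee 2014, §3.1.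
[cite: Kim2002, Theorem A (p. 139) and Thm. 5.3.1 (p. 165)] -/
theorem Kim2003_exteriorSquare_GL4_archimedean.exists_lift_isLAlgebraic
    (h : Kim2003_exteriorSquare_GL4_archimedean)
    (F : Type) [Field F] [NumberField F] (hF : ∀ m : ℕ, isCompact_glFiniteIntegralLevel m F)
    (π : CuspidalAutomorphicRepData 4 F (hF 4)) (hπ : π.1.IsLAlgebraic ∨ π.1.IsCAlgebraic) :
    ∃ P : AutomorphicRepData (AutomorphyDatum.gl 6 F (hF 6)),
      P.IsLAlgebraic ∧
      (∀ᶠ v : HeightOneSpectrum (𝓞 F) in Filter.cofinite, ∀ α : Multiset ℂ,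
        π.1.HasSatakeParamAt v α → P.HasSatakeParamAt v (wedgeTwoParams α)) ∧
      (∀ χ : (F →+* ℂ) → Multiset ℂ, π.1.HasArchParameter χ →
        P.HasArchParameter fun σ : F →+* ℂ => wedgeTwoArchParams (χ σ)) ∧
      ∃ (k : ℕ) (m : Fin k → ℕ) (σ : ∀ i : Fin k, CuspidalAutomorphicRepData (m i) F (hF (m i))),
        (∑ i, m i = 6) ∧
        ∀ᶠ v : HeightOneSpectrum (𝓞 F) in Filter.cofinite, ∀ β : Fin k → Multiset ℂ,
          (∀ i, (σ i).1.HasSatakeParamAt v (β i)) → P.HasSatakeParamAt v (∑ i, β i) := by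
  obtain ⟨P, hP, harch, hiso⟩ := h F hF π
  exact ⟨P, AutomorphicRepData.isLAlgebraic_of_hasArchParameter_wedgeTwo harch hπ, hP, harch, hiso⟩

end Literature.NumberTheory.Automorphic

end
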